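import Summits.Ventures.PercRepro.SeriesParallelC005

/-!
# C-005 is symmetric in its four marks

The C-005 inequality `x₁ x₂ + x₁ x₃ + x₂ x₃ ≤ top · bot` is symmetric under every permutation of
the marks `a, b, c, d`: a permutation of the marks permutes the three pairings `ab|cd`, `ac|bd`,
`ad|bc` among themselves and fixes the rows `abcd` and `a|b|c|d`. `partitionEvent_comp` moves a
permutation of the marks to the row, `partitionEvent_congr` identifies rows that describe the same
partition, the finite lemma `pairRow_perm` (a kernel check over the 256 maps `Fin 4 → Fin 4`)
finds for every permutation the induced permutation of the three pairings, and
**`C005At_perm`** is the symmetry itself.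
-/

namespace PercRepro

namespace MultiGraph

variable {V E : Type}

/-- Permuting the marks by `τ` (with inverse `τ'`) is the same as permuting the row by `τ'`. -/
theorem partitionEvent_comp (G : MultiGraph V E) {k : ℕ} (m : Fin k → V) (rgs : Fin k → ℕ)
    (τ τ' : Fin k → Fin k) (h1 : ∀ i, τ' (τ i) = i) (h2 : ∀ i, τ (τ' i) = i) :
    G.partitionEvent (m ∘ τ) rgs = G.partitionEvent m (rgs ∘ τ') := by
  ext ω
  simp only [partitionEvent, Set.mem_setOf_eq, Function.comp_apply]
  constructor
  · intro H i j
    have := H (τ' i) (τ' j)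
    rwa [h2, h2] at this
  · intro H i j
    have := H (τ i) (τ j)
    rwa [h1, h1] at this

/-- Two rows describe the same partition of the marks: the same pairs carry equal labels. -/
def SameRow {k : ℕ} (r r' : Fin k → ℕ) : Prop := ∀ i j, r i = r j ↔ r' i = r' j

/-- `SameRow` is decidable. -/
instance {k : ℕ} (r r' : Fin k → ℕ) : Decidable (SameRow r r') := by
  unfold SameRow
  infer_instance

/-- Rows describing the same partition give the same event. -/
theorem partitionEvent_congr (G : MultiGraph V E) {k : ℕ} (m : Fin k → V) {rgs rgs' : Fin k → ℕ}
    (h : SameRow rgs rgs') : G.partitionEvent m rgs = G.partitionEvent m rgs' := by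
  ext ω
  simp only [partitionEvent, Set.mem_setOf_eq]
  constructor
  · intro H i j
    rw [H i j, h i j]
  · intro H i j
    rw [H i j, h i j]

/-- The three pairing rows `ab|cd`, `ac|bd`, `ad|bc`. -/
def pairRow : Fin 3 → Fin 4 → ℕ := ![![0, 0, 1, 1], ![0, 1, 0, 1], ![0, 1, 1, 0]]

/-- A row permuted by a permutation of the marks (`SameRow` with each of the three pairings, in one
of the six ways). -/
def PairingsPermuted (τ' : Fin 4 → Fin 4) : Prop :=
  (SameRow (pairRow 0 ∘ τ') (pairRow 0) ∧ SameRow (pairRow 1 ∘ τ') (pairRow 1) ∧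
      SameRow (pairRow 2 ∘ τ') (pairRow 2)) ∨
    (SameRow (pairRow 0 ∘ τ') (pairRow 0) ∧ SameRow (pairRow 1 ∘ τ') (pairRow 2) ∧
      SameRow (pairRow 2 ∘ τ') (pairRow 1)) ∨
    (SameRow (pairRow 0 ∘ τ') (pairRow 1) ∧ SameRow (pairRow 1 ∘ τ') (pairRow 0) ∧
      SameRow (pairRow 2 ∘ τ') (pairRow 2)) ∨
    (SameRow (pairRow 0 ∘ τ') (pairRow 1) ∧ SameRow (pairRow 1 ∘ τ') (pairRow 2) ∧
      SameRow (pairRow 2 ∘ τ') (pairRow 0)) ∨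
    (SameRow (pairRow 0 ∘ τ') (pairRow 2) ∧ SameRow (pairRow 1 ∘ τ') (pairRow 0) ∧
      SameRow (pairRow 2 ∘ τ') (pairRow 1)) ∨
    (SameRow (pairRow 0 ∘ τ') (pairRow 2) ∧ SameRow (pairRow 1 ∘ τ') (pairRow 1) ∧
      SameRow (pairRow 2 ∘ τ') (pairRow 0))

/-- `PairingsPermuted` is decidable. -/
instance (τ' : Fin 4 → Fin 4) : Decidable (PairingsPermuted τ') := by
  unfold PairingsPermuted
  infer_instance

/-- **Every permutation of the marks permutes the three pairings and fixes the extreme rows**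
(a finite check over the 256 maps `Fin 4 → Fin 4`). -/
theorem pairRow_perm : ∀ τ' : Fin 4 → Fin 4, Function.Injective τ' → PairingsPermuted τ' ∧
    SameRow (![0, 0, 0, 0] ∘ τ') ![0, 0, 0, 0] ∧ SameRow (![0, 1, 2, 3] ∘ τ') ![0, 1, 2, 3] := by
  decide +kernel

variable [Fintype E] [DecidableEq E]

/-- C-005 written with the rows of the marks `m`. -/
theorem C005At_iff_rows (G : MultiGraph V E) (p : E → ℝ) (m : Fin 4 → V) :
    G.C005At p (m 0) (m 1) (m 2) (m 3) ↔
      prob p (G.partitionEvent m (pairRow 0)) * prob p (G.partitionEvent m (pairRow 1)) +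
          prob p (G.partitionEvent m (pairRow 0)) * prob p (G.partitionEvent m (pairRow 2)) +
          prob p (G.partitionEvent m (pairRow 1)) * prob p (G.partitionEvent m (pairRow 2)) ≤
        prob p (G.partitionEvent m ![0, 0, 0, 0]) * prob p (G.partitionEvent m ![0, 1, 2, 3]) := by
  have hm : (![m 0, m 1, m 2, m 3] : Fin 4 → V) = m := by
    funext i
    fin_cases i <;> rfl
  unfold C005At
  rw [hm]
  exact Iff.rfl

/-- **C-005 is symmetric in the marks**: if it holds for the marks `m 0, m 1, m 2, m 3` it holds
for `m (τ 0), m (τ 1), m (τ 2), m (τ 3)` for every permutation `τ` of `Fin 4` (given with its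
inverse `τ'`). -/
theorem C005At_perm (G : MultiGraph V E) (p : E → ℝ) (m : Fin 4 → V) (τ τ' : Fin 4 → Fin 4)
    (h1 : ∀ i, τ' (τ i) = i) (h2 : ∀ i, τ (τ' i) = i) (h : G.C005At p (m 0) (m 1) (m 2) (m 3)) :
    G.C005At p (m (τ 0)) (m (τ 1)) (m (τ 2)) (m (τ 3)) := by
  have hinj : Function.Injective τ' := fun i j hij => by rw [← h2 i, ← h2 j, hij]
  obtain ⟨hpair, htop, hbot⟩ := pairRow_perm τ' hinj
  rw [C005At_iff_rows] at h
  refine (C005At_iff_rows G p (m ∘ τ)).2 ?_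
  rw [G.partitionEvent_comp m (pairRow 0) τ τ' h1 h2, G.partitionEvent_comp m (pairRow 1) τ τ' h1 h2,
    G.partitionEvent_comp m (pairRow 2) τ τ' h1 h2, G.partitionEvent_comp m ![0, 0, 0, 0] τ τ' h1 h2,
    G.partitionEvent_comp m ![0, 1, 2, 3] τ τ' h1 h2, G.partitionEvent_congr m htop,
    G.partitionEvent_congr m hbot]
  rcases hpair with ⟨e0, e1, e2⟩ | ⟨e0, e1, e2⟩ | ⟨e0, e1, e2⟩ | ⟨e0, e1, e2⟩ | ⟨e0, e1, e2⟩ |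
    ⟨e0, e1, e2⟩ <;>
    (rw [G.partitionEvent_congr m e0, G.partitionEvent_congr m e1, G.partitionEvent_congr m e2]
     linarith)

end MultiGraph

end PercRepro
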